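import Mathlib
import HarnessLib
import Summits.ResolutionOfSingularities.ResolutionOfSingularities.Theorems.WildQuotientsWildQuotientResolutionS1aA1Move2Node
import Summits.ResolutionOfSingularities.ResolutionOfSingularities.Theorems.WildQuotientsWildQuotientResolutionS1aRecoordStep
import Summits.ResolutionOfSingularities.ResolutionOfSingularities.Theorems.WildQuotientsWildQuotientResolutionS1aD4Root

/-!
# S1a — INSTANCE I-3 (D₄): the FREE MODEL of the node of `N(x₁)` in the RE-COORDINATED form `z′ = x₂ − s·X₁′`, packaged

[OURS · L1 W4.5c · lead-1 g13; plan-1 RULING R-F15e (I-3 move-by-move in the I-2 architecture), NOTES `D4 TREE OF RECORD` (polynomial shear before move 2);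
pattern of ✓`…S1aA1Move2Node`] — NOT statements of the manuscript; counted 0; AI-level work, weaker than expert review. Crux stmt-ResolutionOfSingularities-17941
`CyclicQuotientFourfolds`, line `s1a-logminvertex` v13 (`stub_reachLowerInFX`).
* `d4_sigmaP_X_some_three` — the `x₃`-row of `σ_P` on the cobordant model for the D₄ datum: `σ_P x₃ = x₃ + (sX₁′)·x₂·(sX₁′ − x₂)`;
* ★★ `exists_d4NormChartModel` — `∃ h Φ`: `Φ : ChartRing ≃+* k[s, X₀′, X₁′, z′, x₃][1/h]` = ✓`chartRingEquivAway ∘ a1ModelEquiv` composed with the triangular shear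
  ✓`exists_shearAwayEquiv` (`x₂ = z′ + sX₁′`), `h = (∏ⱼ (X₁′ + j·X₀′s))^{2d}`, with the rows of `τ′ = Φ⁻¹σΦ` (`z′` FIXED, `τ′x₃ = x₃ − sX₁′z′(z′ + sX₁′)`), the fixed
  generators, the degrees and the residual-section pin — every hypothesis of ✓`d4_move2` / ✓`d4_killsIn_two` about the model.
-/

set_option linter.dupNamespace false

noncomputable section

open Literature.AlgebraicGeometry.Resolution
open scoped LaurentPolynomial
open MvPolynomial
open Summit.ResolutionOfSingularities.ResolutionOfSingularities.Theorems.WildQuotientResolution.S1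
open Summit.ResolutionOfSingularities.ResolutionOfSingularities.Theorems.WildQuotientResolution.S1.CoarseChart
open Summit.ResolutionOfSingularities.ResolutionOfSingularities.Theorems.WildQuotientResolution.S1.ProducerStep
open Summit.ResolutionOfSingularities.ResolutionOfSingularities.Theorems.WildQuotientResolution.S1.ReesBigrading
open Summit.ResolutionOfSingularities.ResolutionOfSingularities.Theorems.WildQuotientResolution.S1.NodeTransport
open Summit.ResolutionOfSingularities.ResolutionOfSingularities.Theorems.WildQuotientResolution.S1.CobordantTransport
open Summit.ResolutionOfSingularities.ResolutionOfSingularities.Theorems.WildQuotientResolution.S1.BlowupCharts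
open Summit.ResolutionOfSingularities.ResolutionOfSingularities.Theorems.WildQuotientResolution.S1.FreeModel
open Summit.ResolutionOfSingularities.ResolutionOfSingularities.Theorems.WildQuotientResolution.S1.KillCert.A1

namespace Summit.ResolutionOfSingularities.ResolutionOfSingularities.Theorems.WildQuotientResolution.S1.KillCert.D4

variable {k : Type} [Field k] {A : Type} [CommRing A]
  (σ : MvPolynomial (Fin 4) k ≃+* MvPolynomial (Fin 4) k) (hC : ∀ a : k, σ (C a) = C a)
  (h0 : σ (X 0) = X 0) (h1 : σ (X 1) = X 1 + X 0) (h2 : σ (X 2) = X 2 + X 0) (h3 : σ (X 3) = X 3 + X 1 * (X 2 * (X 1 - X 2)))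
  (e : A ≃+* MvPolynomial (Fin 4) k) (τ : A ≃+* A) (hact : ∀ t : A, τ t = e.symm (σ (e t)))
  {p : ℕ} [NeZero p] (hp : 0 < p) (hσp : ∀ x : A, (⇑τ)^[p] x = x)
  (hσJ : ∀ n : ℕ, ((weightedFiltration (⇑e.symm ∘ ![X 0, X 1] : Fin 2 → A) ![2, 1]).ideal n).map (τ : A →+* A) ≤
    (weightedFiltration (⇑e.symm ∘ ![X 0, X 1] : Fin 2 → A) ![2, 1]).ideal n)
  {m : ℕ} (r : Fin m → ℕ) (𝒜 : (Π j : Fin m, ZMod (r j)) → AddSubgroup A) [GradedRing 𝒜]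
  (hf : ∀ i, (⇑e.symm ∘ ![X 0, X 1] : Fin 2 → A) i ∈ 𝒜 ((fun _ => (0 : Π j : Fin m, ZMod (r j))) i))
  (hx2 : e.symm (X 2) ∈ 𝒜 0) (d : ℕ) (y : ↥(𝒜 0))
  (hyval : (y : A) = (∏ i : ZMod p, (e.symm (X 1) + (i.val : A) * e.symm (X 0))) ^ (2 * d))
  (hy : y ∈ (traceFiltration 𝒜 (⇑e.symm ∘ ![X 0, X 1] : Fin 2 → A) ![2, 1]).ideal (d * (2 * p))) (hσy : τ (y : A) = y)

omit [NeZero p] in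
include hact h3 in
/-- `σ_P x₃ = x₃ + (s·X₁′)·x₂·(s·X₁′ − x₂)` on the cobordant model for the D₄ datum. -/
theorem d4_sigmaP_X_some_three : conj (a1ModelEquiv e) (sigmaR τ _ _ hσJ hp hσp) (X (some 3)) =
    X (some 3) + X none * X (some 1) * X (some 2) * (X none * X (some 1) - X (some 2)) := by
  have hx := congrArg (conj (a1ModelEquiv e) (sigmaR τ _ _ hσJ hp hσp)) (a1ModelEquiv_algebraMap_symm_X_three e)
  rw [← hx, conj_apply_map, sigmaR_algebraMap, act_symm σ e τ hact, h3]
  simp only [map_add, map_mul, map_sub, a1ModelEquiv_algebraMap_symm_X_three, a1ModelEquiv_algebraMap_symm_X_two, (a1ModelEquiv_algebraMap_symm_X_zero_one e).2]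
  ring

include hC h0 h1 h2 h3 hact hx2 hyval in
set_option maxHeartbeats 4000000 in
/-- ★★ **THE FREE MODEL OF THE NODE OF `N(x₁)` FOR D₄, RE-COORDINATED AND PACKAGED.** See the module docstring.
[OURS · L1 W4.5c · (F-T8) models, D₄; NOT a statement of the manuscript] -/
theorem exists_d4NormChartModel :
    letI := chartNodeGradedRing r 𝒜 (⇑e.symm ∘ ![X 0, X 1] : Fin 2 → A) ![2, 1] hf (d * (2 * p)) y hy
    ∃ (hh : MvPolynomial (Option (Fin 4)) k) (Φ : ChartRing 𝒜 (⇑e.symm ∘ ![X 0, X 1] : Fin 2 → A) ![2, 1] (d * (2 * p)) y hy ≃+* Localization.Away hh),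
      hh = (∏ j : ZMod p, (X (some 1) + C (j.val : k) * (X (some 0) * X none))) ^ (2 * d) ∧
      -- rows of `τ′ = conj Φ σ_chart` in the coordinates `(s, X₀′, X₁′, z′, x₃)`
      conj Φ (sigmaChart 𝒜 (⇑e.symm ∘ ![X 0, X 1] : Fin 2 → A) ![2, 1] (d * (2 * p)) y hy τ hσJ hp hσp hσy) (algebraMap (MvPolynomial (Option (Fin 4)) k) (Localization.Away hh) (X none)) =
        algebraMap (MvPolynomial (Option (Fin 4)) k) (Localization.Away hh) (X none) ∧
      conj Φ (sigmaChart 𝒜 (⇑e.symm ∘ ![X 0, X 1] : Fin 2 → A) ![2, 1] (d * (2 * p)) y hy τ hσJ hp hσp hσy) (algebraMap (MvPolynomial (Option (Fin 4)) k) (Localization.Away hh) (X (some 0))) =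
        algebraMap (MvPolynomial (Option (Fin 4)) k) (Localization.Away hh) (X (some 0)) ∧
      conj Φ (sigmaChart 𝒜 (⇑e.symm ∘ ![X 0, X 1] : Fin 2 → A) ![2, 1] (d * (2 * p)) y hy τ hσJ hp hσp hσy) (algebraMap (MvPolynomial (Option (Fin 4)) k) (Localization.Away hh) (X (some 1))) =
        algebraMap (MvPolynomial (Option (Fin 4)) k) (Localization.Away hh) (X (some 1)) +
          algebraMap (MvPolynomial (Option (Fin 4)) k) (Localization.Away hh) (X (some 0)) * algebraMap (MvPolynomial (Option (Fin 4)) k) (Localization.Away hh) (X none) ∧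
      conj Φ (sigmaChart 𝒜 (⇑e.symm ∘ ![X 0, X 1] : Fin 2 → A) ![2, 1] (d * (2 * p)) y hy τ hσJ hp hσp hσy) (algebraMap (MvPolynomial (Option (Fin 4)) k) (Localization.Away hh) (X (some 2))) =
        algebraMap (MvPolynomial (Option (Fin 4)) k) (Localization.Away hh) (X (some 2)) ∧
      conj Φ (sigmaChart 𝒜 (⇑e.symm ∘ ![X 0, X 1] : Fin 2 → A) ![2, 1] (d * (2 * p)) y hy τ hσJ hp hσp hσy) (algebraMap (MvPolynomial (Option (Fin 4)) k) (Localization.Away hh) (X (some 3))) =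
        algebraMap (MvPolynomial (Option (Fin 4)) k) (Localization.Away hh) (X (some 3)) -
          algebraMap (MvPolynomial (Option (Fin 4)) k) (Localization.Away hh) (X none) * algebraMap (MvPolynomial (Option (Fin 4)) k) (Localization.Away hh) (X (some 1)) *
            algebraMap (MvPolynomial (Option (Fin 4)) k) (Localization.Away hh) (X (some 2)) *
            (algebraMap (MvPolynomial (Option (Fin 4)) k) (Localization.Away hh) (X (some 2)) +
              algebraMap (MvPolynomial (Option (Fin 4)) k) (Localization.Away hh) (X none) * algebraMap (MvPolynomial (Option (Fin 4)) k) (Localization.Away hh) (X (some 1))) ∧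
      (∀ g' ∈ (({IsLocalization.Away.invSelf hh} : Set (Localization.Away hh)) ∪ Set.range (algebraMap k (Localization.Away hh))),
        conj Φ (sigmaChart 𝒜 (⇑e.symm ∘ ![X 0, X 1] : Fin 2 → A) ![2, 1] (d * (2 * p)) y hy τ hσJ hp hσp hσy) g' = g') ∧
      conj Φ (sigmaChart 𝒜 (⇑e.symm ∘ ![X 0, X 1] : Fin 2 → A) ![2, 1] (d * (2 * p)) y hy τ hσJ hp hσp hσy) (algebraMap (MvPolynomial (Option (Fin 4)) k) (Localization.Away hh) hh) =
        algebraMap (MvPolynomial (Option (Fin 4)) k) (Localization.Away hh) hh ∧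
      -- degrees relative to `θ = consIndexEquiv r (1, 0)`
      algebraMap (MvPolynomial (Option (Fin 4)) k) (Localization.Away hh) (X (some 0)) ∈ mapGrading (chartNodeGrading r 𝒜 (⇑e.symm ∘ ![X 0, X 1] : Fin 2 → A) ![2, 1] hf (d * (2 * p)) y hy) Φ (2 • consIndexEquiv r ((1 : ℤ), 0)) ∧
      algebraMap (MvPolynomial (Option (Fin 4)) k) (Localization.Away hh) (X (some 2)) ∈ mapGrading (chartNodeGrading r 𝒜 (⇑e.symm ∘ ![X 0, X 1] : Fin 2 → A) ![2, 1] hf (d * (2 * p)) y hy) Φ 0 ∧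
      algebraMap (MvPolynomial (Option (Fin 4)) k) (Localization.Away hh) (X (some 1)) ∈ mapGrading (chartNodeGrading r 𝒜 (⇑e.symm ∘ ![X 0, X 1] : Fin 2 → A) ![2, 1] hf (d * (2 * p)) y hy) Φ (consIndexEquiv r ((1 : ℤ), 0)) ∧
      algebraMap (MvPolynomial (Option (Fin 4)) k) (Localization.Away hh) (X none) ∈ mapGrading (chartNodeGrading r 𝒜 (⇑e.symm ∘ ![X 0, X 1] : Fin 2 → A) ![2, 1] hf (d * (2 * p)) y hy) Φ (-consIndexEquiv r ((1 : ℤ), 0)) ∧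
      IsLocalization.Away.invSelf hh ∈ mapGrading (chartNodeGrading r 𝒜 (⇑e.symm ∘ ![X 0, X 1] : Fin 2 → A) ![2, 1] hf (d * (2 * p)) y hy) Φ (-((d * (2 * p)) • consIndexEquiv r ((1 : ℤ), 0))) ∧
      -- the residual-section pin
      (∀ n : ℕ, Φ (algebraMap _ (ChartRing 𝒜 (⇑e.symm ∘ ![X 0, X 1] : Fin 2 → A) ![2, 1] (d * (2 * p)) y hy) (cobordantAlgebra.u' (⇑e.symm ∘ ![X 0, X 1] : Fin 2 → A) ![2, 1] 0 ^ n) *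
          IsLocalization.Away.invSelf (coverElement 𝒜 (⇑e.symm ∘ ![X 0, X 1] : Fin 2 → A) ![2, 1] (d * (2 * p)) y hy)) =
        algebraMap (MvPolynomial (Option (Fin 4)) k) (Localization.Away hh) (X (some 0)) ^ n * IsLocalization.Away.invSelf hh) := by
  letI := chartNodeGradedRing r 𝒜 (⇑e.symm ∘ ![X 0, X 1] : Fin 2 → A) ![2, 1] hf (d * (2 * p)) y hy
  -- ### the un-sheared model `Φ₀ : ChartRing ≃+* k[x_none, x′][1/h]`
  have g0 := a1_model_degree_X_some_zero' e r 𝒜 hf y hy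
  have g2 := a1_model_degree_X_some_two e r 𝒜 hf hx2 y hy
  have g1 := a1_model_degree_X_some_one' e r 𝒜 hf y hy
  have gs := a1_model_degree_X_none' e r 𝒜 hf y hy
  have gη := a1_model_degree_invSelf' e r 𝒜 hf y hy
  have gres := fun n => chartRingEquivAway_residualSection e r 𝒜 hf y hy n
  set hh := a1ModelEquiv e (coverElement 𝒜 (⇑e.symm ∘ ![X 0, X 1] : Fin 2 → A) ![2, 1] (d * (2 * p)) y hy) with hhdef
  have hhh : hh = (∏ j : ZMod p, (X (some 1) + C (j.val : k) * (X (some 0) * X none))) ^ (2 * d) := a1ModelEquiv_coverElement_one e r 𝒜 (p := p) d rfl y hyval hy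
  set Φ₀ := chartRingEquivAway 𝒜 (⇑e.symm ∘ ![X 0, X 1] : Fin 2 → A) ![2, 1] (d * (2 * p)) y hy (a1ModelEquiv e) with hΦ₀def
  letI := mapGradedRing (chartNodeGrading r 𝒜 (⇑e.symm ∘ ![X 0, X 1] : Fin 2 → A) ![2, 1] hf (d * (2 * p)) y hy) Φ₀
  have q0 : conj Φ₀ (sigmaChart 𝒜 (⇑e.symm ∘ ![X 0, X 1] : Fin 2 → A) ![2, 1] (d * (2 * p)) y hy τ hσJ hp hσp hσy) (algebraMap (MvPolynomial (Option (Fin 4)) k) (Localization.Away hh) (X none)) = algebraMap (MvPolynomial (Option (Fin 4)) k) (Localization.Away hh) (X none) := by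
    rw [hΦ₀def, a1_modelSigma_apply_algebraMap, a1_sigmaP_X_none]
  have q1 : conj Φ₀ (sigmaChart 𝒜 (⇑e.symm ∘ ![X 0, X 1] : Fin 2 → A) ![2, 1] (d * (2 * p)) y hy τ hσJ hp hσp hσy) (algebraMap (MvPolynomial (Option (Fin 4)) k) (Localization.Away hh) (X (some 0))) = algebraMap (MvPolynomial (Option (Fin 4)) k) (Localization.Away hh) (X (some 0)) := by
    rw [hΦ₀def, a1_modelSigma_apply_algebraMap, a1_sigmaP_X_some_zero σ h0 e τ hact]
  have q2 : conj Φ₀ (sigmaChart 𝒜 (⇑e.symm ∘ ![X 0, X 1] : Fin 2 → A) ![2, 1] (d * (2 * p)) y hy τ hσJ hp hσp hσy) (algebraMap (MvPolynomial (Option (Fin 4)) k) (Localization.Away hh) (X (some 1))) =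
      algebraMap (MvPolynomial (Option (Fin 4)) k) (Localization.Away hh) (X (some 1)) + algebraMap (MvPolynomial (Option (Fin 4)) k) (Localization.Away hh) (X (some 0)) * algebraMap (MvPolynomial (Option (Fin 4)) k) (Localization.Away hh) (X none) := by
    rw [hΦ₀def, a1_modelSigma_apply_algebraMap, a1_sigmaP_X_some_one σ h1 e τ hact, map_add, map_mul]
  have q3 : conj Φ₀ (sigmaChart 𝒜 (⇑e.symm ∘ ![X 0, X 1] : Fin 2 → A) ![2, 1] (d * (2 * p)) y hy τ hσJ hp hσp hσy) (algebraMap (MvPolynomial (Option (Fin 4)) k) (Localization.Away hh) (X (some 2))) =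
      algebraMap (MvPolynomial (Option (Fin 4)) k) (Localization.Away hh) (X (some 2)) + algebraMap (MvPolynomial (Option (Fin 4)) k) (Localization.Away hh) (X none) ^ 2 * algebraMap (MvPolynomial (Option (Fin 4)) k) (Localization.Away hh) (X (some 0)) := by
    rw [hΦ₀def, a1_modelSigma_apply_algebraMap, a1_sigmaP_X_some_two σ h2 e τ hact, map_add, map_mul, map_pow]
  have q4 : conj Φ₀ (sigmaChart 𝒜 (⇑e.symm ∘ ![X 0, X 1] : Fin 2 → A) ![2, 1] (d * (2 * p)) y hy τ hσJ hp hσp hσy) (algebraMap (MvPolynomial (Option (Fin 4)) k) (Localization.Away hh) (X (some 3))) =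
      algebraMap (MvPolynomial (Option (Fin 4)) k) (Localization.Away hh) (X (some 3) + X none * X (some 1) * X (some 2) * (X none * X (some 1) - X (some 2))) := by
    rw [hΦ₀def, a1_modelSigma_apply_algebraMap, d4_sigmaP_X_some_three σ h3 e τ hact]
  have q5η : conj Φ₀ (sigmaChart 𝒜 (⇑e.symm ∘ ![X 0, X 1] : Fin 2 → A) ![2, 1] (d * (2 * p)) y hy τ hσJ hp hσp hσy) (IsLocalization.Away.invSelf hh) = IsLocalization.Away.invSelf hh :=
    a1_modelSigma_invSelf e τ hp hσp hσJ r 𝒜 y hy hσy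
  have q5C : ∀ a : k, conj Φ₀ (sigmaChart 𝒜 (⇑e.symm ∘ ![X 0, X 1] : Fin 2 → A) ![2, 1] (d * (2 * p)) y hy τ hσJ hp hσp hσy) (algebraMap (MvPolynomial (Option (Fin 4)) k) (Localization.Away hh) (C a)) =
      algebraMap (MvPolynomial (Option (Fin 4)) k) (Localization.Away hh) (C a) := fun a => by
    rw [hΦ₀def, a1_modelSigma_apply_algebraMap, a1_sigmaP_C σ hC e τ hact]
  have qh : conj Φ₀ (sigmaChart 𝒜 (⇑e.symm ∘ ![X 0, X 1] : Fin 2 → A) ![2, 1] (d * (2 * p)) y hy τ hσJ hp hσp hσy) (algebraMap (MvPolynomial (Option (Fin 4)) k) (Localization.Away hh) hh) = algebraMap (MvPolynomial (Option (Fin 4)) k) (Localization.Away hh) hh := by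
    rw [hΦ₀def, a1_modelSigma_apply_algebraMap e τ hp hσp hσJ r 𝒜 y hy hσy, a1_sigmaP_h e τ hp hσp hσJ r 𝒜 y hy hσy]
  -- ### the triangular shear `x₂ ↦ z′ + s·X₁′`
  have hq : (some 2 : Option (Fin 4)) ∉ (X none * X (some 1) : MvPolynomial (Option (Fin 4)) k).vars := by
    intro h; have h' := MvPolynomial.vars_mul _ _ h; rw [MvPolynomial.vars_X, MvPolynomial.vars_X] at h'; simp at h'
  obtain ⟨α, Θ, hα0, hαX, hΘ, hΘ0, hΘX, hΘinv⟩ := exists_shearAwayEquiv k (some 2 : Option (Fin 4)) (X none * X (some 1)) hq hh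
  have hαC : ∀ a : k, α (C a) = C a := fun a => by simpa [MvPolynomial.algebraMap_eq] using α.commutes a
  have hαh : α hh = hh := by
    rw [hhh, map_pow, map_prod]
    refine congrArg (· ^ (2 * d)) (Finset.prod_congr rfl fun j _ => ?_)
    rw [map_add, map_mul, map_mul, hαC, hαX _ (by decide), hαX _ (by decide), hαX _ (by decide)]
  -- rows through `Θ`
  have hτΘ : ∀ x, conj (Φ₀.trans Θ) (sigmaChart 𝒜 (⇑e.symm ∘ ![X 0, X 1] : Fin 2 → A) ![2, 1] (d * (2 * p)) y hy τ hσJ hp hσp hσy) (Θ x) =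
      Θ (conj Φ₀ (sigmaChart 𝒜 (⇑e.symm ∘ ![X 0, X 1] : Fin 2 → A) ![2, 1] (d * (2 * p)) y hy τ hσJ hp hσp hσy) x) := fun x => by
    rw [conj_apply, conj_apply, RingEquiv.symm_trans_apply, Θ.symm_apply_apply, RingEquiv.trans_apply]
  have hz' : algebraMap (MvPolynomial (Option (Fin 4)) k) (Localization.Away (α hh)) (X (some 2)) =
      Θ (algebraMap (MvPolynomial (Option (Fin 4)) k) (Localization.Away hh) (X (some 2)) - algebraMap (MvPolynomial (Option (Fin 4)) k) (Localization.Away hh) (X none) * algebraMap (MvPolynomial (Option (Fin 4)) k) (Localization.Away hh) (X (some 1))) := by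
    rw [map_sub, map_mul, hΘ0, hΘX _ (by decide), hΘX _ (by decide), map_mul]; ring
  have hdegΘ : ∀ {x : Localization.Away hh} {i : Π j : Fin (m + 1), ZMod ((Fin.cons 0 r : Fin (m + 1) → ℕ) j)},
      x ∈ mapGrading (chartNodeGrading r 𝒜 (⇑e.symm ∘ ![X 0, X 1] : Fin 2 → A) ![2, 1] hf (d * (2 * p)) y hy) Φ₀ i →
      Θ x ∈ mapGrading (chartNodeGrading r 𝒜 (⇑e.symm ∘ ![X 0, X 1] : Fin 2 → A) ![2, 1] hf (d * (2 * p)) y hy) (Φ₀.trans Θ) i := by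
    intro x i hx
    rw [mem_mapGrading_iff] at hx ⊢
    rw [RingEquiv.symm_trans_apply, Θ.symm_apply_apply]
    exact hx
  refine ⟨α hh, Φ₀.trans Θ, by rw [hαh, hhh], ?_, ?_, ?_, ?_, ?_, ?_, ?_, ?_, ?_, ?_, ?_, ?_, ?_⟩
  · rw [← hΘX none (by decide), hτΘ, q0]
  · rw [← hΘX (some 0) (by decide), hτΘ, q1]
  · rw [← hΘX (some 1) (by decide), hτΘ, q2, map_add, map_mul, hΘX _ (by decide), hΘX _ (by decide), hΘX _ (by decide)]
  · rw [hz', hτΘ, map_sub, map_mul, q3, q0, q2]; congr 1; ring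
  · rw [← hΘX (some 3) (by decide), hτΘ, q4, hΘ]
    simp only [map_add, map_mul, map_sub, hα0, hαX (some 3) (by decide), hαX none (by decide), hαX (some 1) (by decide), hΘX (some 3) (by decide)]
    ring
  · rintro g' (hg | ⟨a, rfl⟩)
    · rw [Set.mem_singleton_iff.mp hg, ← hΘinv, hτΘ, q5η]
    · rw [IsScalarTower.algebraMap_apply k (MvPolynomial (Option (Fin 4)) k) (Localization.Away (α hh)) a, MvPolynomial.algebraMap_eq, ← hαC a, ← hΘ, hτΘ, q5C]
  · rw [← hΘ hh, hτΘ, qh]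
  · rw [← hΘX (some 0) (by decide)]; exact hdegΘ g0
  · rw [hz']
    have h1 := SetLike.mul_mem_graded gs g1
    rw [neg_add_cancel] at h1
    exact hdegΘ (sub_mem g2 h1)
  · rw [← hΘX (some 1) (by decide)]; exact hdegΘ g1
  · rw [← hΘX none (by decide)]; exact hdegΘ gs
  · rw [← hΘinv]; exact hdegΘ gη
  · intro n
    rw [RingEquiv.trans_apply, gres n, map_mul, map_pow, hΘX _ (by decide), hΘinv]

end Summit.ResolutionOfSingularities.ResolutionOfSingularities.Theorems.WildQuotientResolution.S1.KillCert.D4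

end
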